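import Mathlib
import Summits.KontsevichZagierPeriods.Zeta5Search.ThirdDigitVProof
import Summits.KontsevichZagierPeriods.Zeta5Search.ThirdDigitWProof
import Summits.KontsevichZagierPeriods.Zeta5Search.SecondOrderPair
import HarnessLib

/-!
# ζ(5) search — normalised class digits TO THIRD ORDER and the third-order conjugation of the class units (tools for THEOREM A⁗)

Cell `pub-zeta5` (HONEST FRAMING: systematic search; no irrationality claim unless certified), typer seat generation 12.
The `SecondOrderPair` §2 layer (typer g11) one order further (REPORT-gen2-g10 §6.2–§6.3), in the normalisation of THEOREM A⁗
(`Ω_x = W_x/(−p)^{m+3}`, `N_x = V_x/(−p)^m`, `m` the minimal multipole exponent):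
* `deep3W_norm` / `deep3V_norm` — exponent `m`: `Ω_x ≡ ĝ_x(ŵ − pφŵ₂ + p²cŵ₃)`, `N_x ≡ ĝ_x(v̂ − pφv̂₂ + p²cv̂₃) (mod p³)`
  ((W3)/(V3), `thirdDigitW_holds` / `thirdDigitV_holds`);
* `sub3W_norm` / `sub3V_norm` — exponent `m+1`: `Ω_y ≡ −pĝ_y(ŵ − pφŵ₂)`, `N_y ≡ −pĝ_y(v̂ − pφv̂₂) (mod p³)` ((W2)/(V2));
* `subsub3W_norm` / `subsub3V_norm` — exponent `m+2`: `Ω_z ≡ p²ĝ_zŵ_z`, `N_z ≡ p²ĝ_zv̂_z (mod p³)` (first digits);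
* `rest3W_norm` / `rest3V_norm` — everything else is `≡ 0 (mod p³)`;
* `phiHat_reflect`, `phi2Hat_reflect`, `curvHat_reflect` (exact reflection `q ↦ b₀ − q`: `φ` odd, `φ₂`, `c` even) and the conjugate-class
  congruences `gHat_conj_third` (`ĝ_x̄ ≡ −ĝ_x(1 − Lpφ_x + L²p²c_x) (mod p³)`, even exponent), `phiHat_conj_second`
  (`φ_x̄ ≡ −(φ_x + Lpφ₂,x) (mod p²)`), `curvHat_conj` (`c_x̄ ≡ c_x (mod p)`).
`p`-adic valuations of rational numbers; nothing here concerns irrationality.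
-/

noncomputable section

open Finset PowerSeries

namespace Summit.KontsevichZagierPeriods.Zeta5Search.SecondOrder

open Summit.KontsevichZagierPeriods.Zeta5Search.DualSeries (InBox)
open Summit.KontsevichZagierPeriods.Zeta5Search.WedgeDictionary (pfData)
open Summit.KontsevichZagierPeriods.Zeta5Search.CasoratianValuation (InPolytope)
open Summit.KontsevichZagierPeriods.Zeta5Search.ClusterValuation
open Summit.KontsevichZagierPeriods.Zeta5Search.PadicSeries
open Summit.KontsevichZagierPeriods.Zeta5Search.CellA (classW padicNorm_pow_eq padicNorm_p gHat_conj)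
open Summit.KontsevichZagierPeriods.Zeta5Search.LevelClass (typeExp level_mem)
open Summit.KontsevichZagierPeriods.Zeta5Search.BigPrime (padicNorm_mul_le_one)

variable {p : ℕ} [hp : Fact p.Prime]

/-! ## §1 Normalised class digits to third order -/

section Digits

variable (b : ℕ → ℤ) (hb : InPolytope b) (hp5 : 5 ≤ p) (hwin : (b 0 + 2 : ℤ) < (p : ℤ) ^ 2) {x : ℕ} (hx : x < p)
include hb hp5 hwin hx

/-- **Deep `W` to third order**: `‖W_x/(−p)^{E+3} − ĝ_x(ŵ_x − pφ_xŵ₂_x + p²c_xŵ₃_x)‖ ≤ p⁻³`. -/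
theorem deep3W_norm (hpole : 1 ≤ classPoleCount b p x) :
    padicNorm p (classW b p x / (-(p : ℚ)) ^ (classExp b p x + 3)
      - gHat b p x * (wHat b p x - (p : ℚ) * phiHat b p x * wHat2 b p x + (p : ℚ) ^ 2 * curvHat b p x * wHat3 b p x)) ≤
      (p : ℚ) ^ (-(3 : ℤ)) := by
  have hp' : (-(p : ℚ)) ^ (classExp b p x + 3) ≠ 0 := zpow_ne_zero _ (neg_ne_zero.2 (Nat.cast_ne_zero.2 hp.out.ne_zero))
  have h := padicNorm_le_of_val (p := p) fun hne => thirdDigitW_holds b p x hb hp.out hp5 hwin hx hpole hne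
  have e : classW b p x / (-(p : ℚ)) ^ (classExp b p x + 3)
      - gHat b p x * (wHat b p x - (p : ℚ) * phiHat b p x * wHat2 b p x + (p : ℚ) ^ 2 * curvHat b p x * wHat3 b p x) =
      ((∑ s ∈ classSet b p x, pfData b 2 s)
        - (-(p : ℚ)) ^ (classExp b p x + 3) * gHat b p x
          * (wHat b p x - (p : ℚ) * phiHat b p x * wHat2 b p x + (p : ℚ) ^ 2 * curvHat b p x * wHat3 b p x))
        / (-(p : ℚ)) ^ (classExp b p x + 3) := by
    unfold classW; field_simp
  rw [e]
  exact norm_div_neg_p_zpow (by rwa [show classExp b p x + 3 + 3 = classExp b p x + 6 by ring])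

/-- **Deep `V` to third order** (`E_x ≤ −3`): `‖V_x/(−p)^E − ĝ_x(v̂_x − pφ_xv̂₂_x + p²c_xv̂₃_x)‖ ≤ p⁻³`. -/
theorem deep3V_norm (hpole : 1 ≤ classPoleCount b p x) (hE3 : classExp b p x ≤ -3) :
    padicNorm p (classV b p x / (-(p : ℚ)) ^ (classExp b p x)
      - gHat b p x * (vHat b p x - (p : ℚ) * phiHat b p x * vHat2 b p x + (p : ℚ) ^ 2 * curvHat b p x * vHat3 b p x)) ≤
      (p : ℚ) ^ (-(3 : ℤ)) := by
  have hp' : (-(p : ℚ)) ^ (classExp b p x) ≠ 0 := zpow_ne_zero _ (neg_ne_zero.2 (Nat.cast_ne_zero.2 hp.out.ne_zero))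
  have h := padicNorm_le_of_val (p := p) fun hne => thirdDigitV_holds b p x hb hp.out hp5 hwin hx hpole hE3 hne
  have e : classV b p x / (-(p : ℚ)) ^ (classExp b p x)
      - gHat b p x * (vHat b p x - (p : ℚ) * phiHat b p x * vHat2 b p x + (p : ℚ) ^ 2 * curvHat b p x * vHat3 b p x) =
      (classV b p x - (-(p : ℚ)) ^ (classExp b p x) * gHat b p x
          * (vHat b p x - (p : ℚ) * phiHat b p x * vHat2 b p x + (p : ℚ) ^ 2 * curvHat b p x * vHat3 b p x))
        / (-(p : ℚ)) ^ (classExp b p x) := by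
    field_simp
  rw [e]
  exact norm_div_neg_p_zpow h

/-- **Exponent `m+1` at order `m+3`, `W`**: `‖W_y/(−p)^{m+3} + pĝ_y(ŵ_y − pφ_yŵ₂_y)‖ ≤ p⁻³`. -/
theorem sub3W_norm (hpole : 1 ≤ classPoleCount b p x) {m : ℤ} (hE : classExp b p x = m + 1) :
    padicNorm p (classW b p x / (-(p : ℚ)) ^ (m + 3)
      + (p : ℚ) * (gHat b p x * (wHat b p x - (p : ℚ) * phiHat b p x * wHat2 b p x))) ≤ (p : ℚ) ^ (-(3 : ℤ)) := by
  have hp0 : (p : ℚ) ≠ 0 := Nat.cast_ne_zero.2 hp.out.ne_zero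
  have hpneg : (-(p : ℚ)) ≠ 0 := neg_ne_zero.2 hp0
  have h := deepW_norm b hb hp5 hwin hx hpole
  have e : classW b p x / (-(p : ℚ)) ^ (m + 3) + (p : ℚ) * (gHat b p x * (wHat b p x - (p : ℚ) * phiHat b p x * wHat2 b p x)) =
      -(p : ℚ) * (classW b p x / (-(p : ℚ)) ^ (classExp b p x + 3)
        - gHat b p x * (wHat b p x - (p : ℚ) * phiHat b p x * wHat2 b p x)) := by
    rw [hE, show m + 1 + 3 = (m + 3) + 1 by ring, zpow_add_one₀ hpneg]; field_simp; ring
  rw [e, padicNorm.mul, padicNorm.neg, padicNorm_p]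
  calc (p : ℚ) ^ (-(1 : ℤ)) * _ ≤ (p : ℚ) ^ (-(1 : ℤ)) * (p : ℚ) ^ (-(2 : ℤ)) := mul_le_mul_of_nonneg_left h (zpow_p_nonneg _)
    _ = (p : ℚ) ^ (-(3 : ℤ)) := by rw [← zpow_add₀ hp0]; norm_num

/-- **Exponent `m+1` at order `m`, `V`** (`E ≤ −2`): `‖V_y/(−p)^m + pĝ_y(v̂_y − pφ_yv̂₂_y)‖ ≤ p⁻³`. -/
theorem sub3V_norm (hpole : 1 ≤ classPoleCount b p x) {m : ℤ} (hE : classExp b p x = m + 1) (hE2 : classExp b p x ≤ -2) :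
    padicNorm p (classV b p x / (-(p : ℚ)) ^ m
      + (p : ℚ) * (gHat b p x * (vHat b p x - (p : ℚ) * phiHat b p x * vHat2 b p x))) ≤ (p : ℚ) ^ (-(3 : ℤ)) := by
  have hp0 : (p : ℚ) ≠ 0 := Nat.cast_ne_zero.2 hp.out.ne_zero
  have hpneg : (-(p : ℚ)) ≠ 0 := neg_ne_zero.2 hp0
  have h := deepV_norm b hb hp5 hwin hx hpole hE2
  have e : classV b p x / (-(p : ℚ)) ^ m + (p : ℚ) * (gHat b p x * (vHat b p x - (p : ℚ) * phiHat b p x * vHat2 b p x)) =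
      -(p : ℚ) * (classV b p x / (-(p : ℚ)) ^ (classExp b p x)
        - gHat b p x * (vHat b p x - (p : ℚ) * phiHat b p x * vHat2 b p x)) := by
    rw [hE, zpow_add_one₀ hpneg]; field_simp; ring
  rw [e, padicNorm.mul, padicNorm.neg, padicNorm_p]
  calc (p : ℚ) ^ (-(1 : ℤ)) * _ ≤ (p : ℚ) ^ (-(1 : ℤ)) * (p : ℚ) ^ (-(2 : ℤ)) := mul_le_mul_of_nonneg_left h (zpow_p_nonneg _)
    _ = (p : ℚ) ^ (-(3 : ℤ)) := by rw [← zpow_add₀ hp0]; norm_num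

/-- **Exponent `m+2` at order `m+3`, `W`**: `‖W_z/(−p)^{m+3} − p²ĝ_zŵ_z‖ ≤ p⁻³`. -/
theorem subsub3W_norm (hpole : 1 ≤ classPoleCount b p x) {m : ℤ} (hE : classExp b p x = m + 2) :
    padicNorm p (classW b p x / (-(p : ℚ)) ^ (m + 3) - (p : ℚ) ^ 2 * (gHat b p x * wHat b p x)) ≤ (p : ℚ) ^ (-(3 : ℤ)) := by
  have hp0 : (p : ℚ) ≠ 0 := Nat.cast_ne_zero.2 hp.out.ne_zero
  have hpneg : (-(p : ℚ)) ≠ 0 := neg_ne_zero.2 hp0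
  have h := subW_norm b hb hp5 hwin hx hpole (m := m + 1) (by rw [hE]; ring)
  have e : classW b p x / (-(p : ℚ)) ^ (m + 3) - (p : ℚ) ^ 2 * (gHat b p x * wHat b p x) =
      -(p : ℚ) * (classW b p x / (-(p : ℚ)) ^ (m + 1 + 3) + (p : ℚ) * gHat b p x * wHat b p x) := by
    rw [show m + 1 + 3 = (m + 3) + 1 by ring, zpow_add_one₀ hpneg]; field_simp; ring
  rw [e, padicNorm.mul, padicNorm.neg, padicNorm_p]
  calc (p : ℚ) ^ (-(1 : ℤ)) * _ ≤ (p : ℚ) ^ (-(1 : ℤ)) * (p : ℚ) ^ (-(2 : ℤ)) := mul_le_mul_of_nonneg_left h (zpow_p_nonneg _)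
    _ = (p : ℚ) ^ (-(3 : ℤ)) := by rw [← zpow_add₀ hp0]; norm_num

/-- **Exponent `m+2` at order `m`, `V`**: `‖V_z/(−p)^m − p²ĝ_zv̂_z‖ ≤ p⁻³`. -/
theorem subsub3V_norm (hpole : 1 ≤ classPoleCount b p x) {m : ℤ} (hE : classExp b p x = m + 2) :
    padicNorm p (classV b p x / (-(p : ℚ)) ^ m - (p : ℚ) ^ 2 * (gHat b p x * vHat b p x)) ≤ (p : ℚ) ^ (-(3 : ℤ)) := by
  have hp0 : (p : ℚ) ≠ 0 := Nat.cast_ne_zero.2 hp.out.ne_zero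
  have hpneg : (-(p : ℚ)) ≠ 0 := neg_ne_zero.2 hp0
  have h := subV_norm b hb hp5 hwin hx hpole (m := m + 1) (by rw [hE]; ring)
  have e : classV b p x / (-(p : ℚ)) ^ m - (p : ℚ) ^ 2 * (gHat b p x * vHat b p x) =
      -(p : ℚ) * (classV b p x / (-(p : ℚ)) ^ (m + 1) + (p : ℚ) * gHat b p x * vHat b p x) := by
    rw [zpow_add_one₀ hpneg]; field_simp; ring
  rw [e, padicNorm.mul, padicNorm.neg, padicNorm_p]
  calc (p : ℚ) ^ (-(1 : ℤ)) * _ ≤ (p : ℚ) ^ (-(1 : ℤ)) * (p : ℚ) ^ (-(2 : ℤ)) := mul_le_mul_of_nonneg_left h (zpow_p_nonneg _)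
    _ = (p : ℚ) ^ (-(3 : ℤ)) := by rw [← zpow_add₀ hp0]; norm_num

omit hx in
/-- **The rest, `W`**: a class without pole, with one pole, or with exponent `≥ m + 3` has `‖W_x/(−p)^{m+3}‖ ≤ p⁻³` (`m ≤ −6`). -/
theorem rest3W_norm {m : ℤ} (hm : m ≤ -6) (hE : 2 ≤ classPoleCount b p x → m + 3 ≤ classExp b p x) :
    padicNorm p (classW b p x / (-(p : ℚ)) ^ (m + 3)) ≤ (p : ℚ) ^ (-(3 : ℤ)) := by
  have h := CellD.padicNorm_classW_le b hb hp5 hwin (m := m + 3) (by omega) hE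
  exact norm_div_neg_p_zpow (by rwa [show m + 3 + 3 = m + 3 + 3 by ring])

/-- **The rest, `V`**: a class without pole or with `ν_x ≥ m + 3` has `‖V_x/(−p)^m‖ ≤ p⁻³`. -/
theorem rest3V_norm {m : ℤ} (hν : 1 ≤ classPoleCount b p x → m + 3 ≤ classNu b p x) :
    padicNorm p (classV b p x / (-(p : ℚ)) ^ m) ≤ (p : ℚ) ^ (-(3 : ℤ)) := by
  have h := CellD.padicNorm_classV_le_of b hb hp5 hwin hx (v := m + 3) hν
  exact norm_div_neg_p_zpow h

end Digits

/-! ## §2 Reflection of `φ`, `φ₂`, `c` and the conjugate class to third order -/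

omit hp in
/-- The centre condition is reflection symmetric. -/
theorem centreIn_reflect (b : ℕ → ℤ) (h0 : 0 ≤ b 0) {q : ℕ} (hq : q ≤ (b 0).toNat) :
    CentreIn b p ((b 0).toNat - q) ↔ CentreIn b p q := by
  have hb0 : b 0 = (((b 0).toNat : ℕ) : ℤ) := (Int.toNat_of_nonneg h0).symm
  unfold CentreIn
  have e : 2 * ((((b 0).toNat - q : ℕ) : ℤ)) - b 0 = -(2 * (q : ℤ) - b 0) := by omega
  rw [e, dvd_neg]

omit hp in
/-- **`φ` is odd and `φ₂` is even under the reflection `q ↦ b₀ − q`** (exact). -/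
theorem phiHat_reflect (b : ℕ → ℤ) (h0 : 0 ≤ b 0) {q : ℕ} (hq : q ≤ (b 0).toNat) :
    phiHat b p ((b 0).toNat - q) = -phiHat b p q ∧ phi2Hat b p ((b 0).toNat - q) = phi2Hat b p q := by
  set N := (b 0).toNat with hN
  have hb0 : ((b 0 : ℤ) : ℚ) = (N : ℚ) := by rw [hN]; exact_mod_cast (Int.toNat_of_nonneg h0).symm
  have hcen : CentreIn b p (N - q) ↔ CentreIn b p q := centreIn_reflect b h0 hq
  -- the far sets correspond under reflection
  set F : ℕ → Finset ℕ := fun r => (range (N + 1)).filter (fun s => s % p ≠ r % p) with hF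
  have hmemF : ∀ {r s : ℕ}, s ∈ F r ↔ s ≤ N ∧ ¬ (p : ℤ) ∣ (s : ℤ) - r := by
    intro r s
    rw [hF]; simp only [mem_filter, mem_range, Nat.lt_succ_iff]
    have : (p : ℤ) ∣ (s : ℤ) - r ↔ s % p = r % p := by
      rw [dvd_sub_comm]; exact (Nat.modEq_iff_dvd).symm
    rw [this]
  have hsum : ∀ (f : ℕ → ℚ), ∑ s ∈ F (N - q), f s = ∑ s ∈ F q, f (N - s) := by
    intro f
    refine (sum_nbij' (fun s => N - s) (fun s => N - s) (fun s hs => ?_) (fun s hs => ?_) (fun s hs => ?_)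
      (fun s hs => ?_) (fun s hs => rfl)).symm
    · obtain ⟨hsN, hnd⟩ := hmemF.1 hs
      refine hmemF.2 ⟨by omega, fun h => hnd ?_⟩
      have e : (s : ℤ) - q = -((((N - s : ℕ) : ℤ)) - ((N - q : ℕ) : ℤ)) := by omega
      rw [e]; exact h.neg_right
    · obtain ⟨hsN, hnd⟩ := hmemF.1 hs
      refine hmemF.2 ⟨by omega, fun h => hnd ?_⟩
      have e : (s : ℤ) - ((N - q : ℕ) : ℤ) = -((((N - s : ℕ) : ℤ)) - q) := by omega
      rw [e]; exact h.neg_right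
    · have := (hmemF.1 hs).1; omega
    · have := (hmemF.1 hs).1; omega
  have hdiff : ∀ s ∈ F q, (((N - s : ℕ) : ℚ) - ((N - q : ℕ) : ℚ)) = -((s : ℚ) - q) := by
    intro s hs
    have hsN := (hmemF.1 hs).1
    push_cast [Nat.cast_sub hsN, Nat.cast_sub hq]; ring
  have hcq : ((b 0 : ℤ) : ℚ) / 2 - ((N - q : ℕ) : ℚ) = -(((b 0 : ℤ) : ℚ) / 2 - q) := by
    rw [hb0]; push_cast [Nat.cast_sub hq]; ring
  constructor
  · unfold phiHat
    rw [show (range ((b 0).toNat + 1)).filter (fun s => s % p ≠ (N - q) % p) = F (N - q) from rfl,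
      show (range ((b 0).toNat + 1)).filter (fun s => s % p ≠ q % p) = F q from rfl, hsum, neg_add, ← sum_neg_distrib]
    congr 1
    · refine sum_congr rfl fun s hs => ?_
      rw [ClusterValuation.netExp_reflect b h0 (hmemF.1 hs).1, hdiff s hs, div_neg]
    · rw [hcq]
      simp only [hcen]
      split_ifs
      · rw [div_neg]
      · rw [neg_zero]
  · unfold phi2Hat
    rw [show (range ((b 0).toNat + 1)).filter (fun s => s % p ≠ (N - q) % p) = F (N - q) from rfl,
      show (range ((b 0).toNat + 1)).filter (fun s => s % p ≠ q % p) = F q from rfl, hsum]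
    congr 1
    · refine sum_congr rfl fun s hs => ?_
      rw [ClusterValuation.netExp_reflect b h0 (hmemF.1 hs).1, hdiff s hs, neg_sq]
    · simp only [hcen, hcq, neg_sq]

omit hp in
/-- **`c` is even under the reflection** (exact). -/
theorem curvHat_reflect (b : ℕ → ℤ) (h0 : 0 ≤ b 0) {q : ℕ} (hq : q ≤ (b 0).toNat) :
    curvHat b p ((b 0).toNat - q) = curvHat b p q := by
  obtain ⟨h1, h2⟩ := phiHat_reflect (p := p) b h0 hq
  unfold curvHat; rw [h1, h2, neg_sq]

section Conj

variable (b : ℕ → ℤ) (hb : InPolytope b) (hp5 : 5 ≤ p)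
  {x L : ℕ} (hx : x < p) (hL : x + L * p ≤ (b 0).toNat) (hL' : (b 0).toNat < x + L * p + p) (hc : ¬ CentreIn b p x)
include hb hp5 hx hL hL' hc

/-- **Conjugate unit to third order (even exponent)**: `‖ĝ_x̄ + ĝ_x(1 − Lpφ_x + L²p²c_x)‖ ≤ p⁻³` (`x̄ = conjClass b p x`). -/
theorem gHat_conj_third (heven : Even (classExp b p x)) :
    padicNorm p (gHat b p (conjClass b p x)
      + gHat b p x * (1 - (L : ℚ) * p * phiHat b p x + ((L : ℚ) * p) ^ 2 * curvHat b p x)) ≤ (p : ℚ) ^ (-(3 : ℤ)) := by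
  have hq := level_mem b hx hL hL' le_rfl
  have hconj : conjClass b p x = (b 0).toNat - (x + L * p) := CellKit.conjClass_eq_level b hL hL'
  have hG2 := gHat_conj b p x (x + L * p) hb hp.out hp5 hx hc hq
  have hodd : Odd (classExp b p x + 1) := heven.add_one
  rw [hodd.neg_one_zpow, neg_one_mul] at hG2
  have hS := padicNorm_gHat_sub_third_le b (by omega) hx hq
  rw [level_div hx] at hS
  have e : gHat b p (conjClass b p x) + gHat b p x * (1 - (L : ℚ) * p * phiHat b p x + ((L : ℚ) * p) ^ 2 * curvHat b p x) =
      -(gHat b p (x + L * p) - gHat b p x * (1 - (L : ℚ) * p * phiHat b p x + ((L : ℚ) * p) ^ 2 * curvHat b p x)) := by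
    rw [hconj, hG2]; ring
  rw [e, padicNorm.neg]
  exact hS

omit hc in
/-- **Conjugate `φ` to second order**: `‖φ_x̄ + (φ_x + Lpφ₂,x)‖ ≤ p⁻²`. -/
theorem phiHat_conj_second :
    padicNorm p (phiHat b p (conjClass b p x) + (phiHat b p x + (L : ℚ) * p * phi2Hat b p x)) ≤ (p : ℚ) ^ (-(2 : ℤ)) := by
  have h0 : 0 ≤ b 0 := hb.1.1
  have hq := level_mem b hx hL hL' le_rfl
  have hconj : conjClass b p x = (b 0).toNat - (x + L * p) := CellKit.conjClass_eq_level b hL hL'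
  have hrefl := (phiHat_reflect (p := p) b h0 (q := x + L * p) hL).1
  have hS := padicNorm_phiHat_sub_second_le b (by omega) hx hq
  rw [level_div hx] at hS
  have e : phiHat b p (conjClass b p x) + (phiHat b p x + (L : ℚ) * p * phi2Hat b p x) =
      -(phiHat b p (x + L * p) - (phiHat b p x + (L : ℚ) * p * phi2Hat b p x)) := by
    rw [hconj, hrefl]; ring
  rw [e, padicNorm.neg]
  exact hS

omit hc in
/-- **Conjugate `c`**: `‖c_x̄ − c_x‖ ≤ p⁻¹`. -/
theorem curvHat_conj : padicNorm p (curvHat b p (conjClass b p x) - curvHat b p x) ≤ (p : ℚ) ^ (-(1 : ℤ)) := by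
  have h0 : 0 ≤ b 0 := hb.1.1
  have hq := level_mem b hx hL hL' le_rfl
  have hconj : conjClass b p x = (b 0).toNat - (x + L * p) := CellKit.conjClass_eq_level b hL hL'
  rw [hconj, curvHat_reflect (p := p) b h0 hL]
  exact padicNorm_curvHat_sub_le b (by omega) hx hq

end Conj

end Summit.KontsevichZagierPeriods.Zeta5Search.SecondOrder

end
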